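import Literature.RepresentationTheory.KonnoKonno2007.RealUnitaryRankOneKAKFibers
import Mathlib.RepresentationTheory.Continuous.Basic
import Mathlib.Analysis.InnerProductSpace.Adjoint
import HarnessLib

/-!
# Descent through the `KAK` map of the rank-one unitary group `U(α,β)`, `|β| = 1`: the operator family
# `Φ(k₁ a_t k₂) := ϖ_K(k₁) ∘ U₀(t) ∘ ϖ_K(k₂)` is well defined, unitary, `K`-bi-covariant and strongly continuous

Topic `RepresentationTheory/KonnoKonno2007`; namespace `Literature.RepresentationTheory.KonnoKonno2007.RealDualPair` (sequel of ★ `RealUnitaryRankOneKAK`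
— `kakMap`, `isQuotientMap_kakMap`, `kakMap_surjective`, `weylKV` — and of ★ `RealUnitaryRankOneKAKFibers` — the fibre lemma `kakMap_fibre`,
`eq_of_kakMap_eq_of_nonneg`, `kakMap_zero_eq`).  Two honest DEFINITIONS with bodies (`kakDescend`, `globOp`) and theorems; no instance, no notation, no named
fact, no `sorry`.  Cell `hodgecm-mathlib`, F0∕P3, the in-house road to the letter A6 `HasUnitaryGlobalizationOfInfUnitary` at `U(2,1)` (ROAD-GLOB v1.1,
brick Φ1, T1a LEAD F0P3b-p01 (g3)).

THE MATHEMATICS ([Knapp2002, Thm. 7.39]; [HarishChandra1953, §9]).  Let `ϖ_K` be a unitary, strongly continuous representation of `K = U(α) × U(β)` on a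
Hilbert space `E` and `U₀ : ℝ → U(E)` a strongly continuous family of unitaries with `U₀(0) = 1` (in the application: the one-parameter unitary group
integrating the boost generator `H₀` on the completion of an admissible `(𝔤, K)`-module), such that (M) `ϖ_K(m)` commutes with every `U₀(t)` whenever
`diag(m)` commutes with `H₀` (`m ∈ M = Z_K(A)`), and (W) `ϖ_K(w) U₀(t) ϖ_K(w)⁻¹ = U₀(−t)` for the Weyl element `w` (★ `weylKV`).  Then
`F(k₁, t, k₂) := ϖ_K(k₁) ∘ U₀(t) ∘ ϖ_K(k₂)` is CONSTANT ON THE FIBRES of `kakMap : K × ℝ × K → U(α,β)` (§2, from the fibre lemma), hence DESCENDS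
(§1, `kakDescend`: a function on `K × ℝ × K` constant on fibres descends along the surjection `kakMap`, continuously by ★ `isQuotientMap_kakMap`) to
**`globOp ϖK U₀ : U(α,β) → (E →L[ℂ] E)`** (§3) with `globOp (k₁ a_t k₂) = ϖ_K(k₁) U₀(t) ϖ_K(k₂)`, `globOp (kV k) = ϖ_K(k)`, `globOp (a_t) = U₀(t)`,
`globOp (kV k · g) = ϖ_K(k) ∘ globOp g`, `globOp (g · kV k) = globOp g ∘ ϖ_K(k)`, `globOp g` unitary, and `g ↦ globOp g v` continuous.  (The GROUP LAW
`globOp (g a_s) = globOp g ∘ U₀ s` is brick Φ2; this file needs no derivative.)  `K` is read through ★ `upqMaximalCompactEquiv : K ≃ₜ* U(α) × U(β)`.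

## Main statements
* `kakDescend`, `kakDescend_kakMap`, `continuous_kakDescend` — descent along `kakMap` of fibre-constant (continuous) maps;
* `kakMap_fibreConstant_of` — the criterion: Weyl symmetry + «`t = 0` sees only `k₁k₂`» + `M`-invariance at `t > 0` ⇒ fibre-constant;
* `globOp`, `globOp_kakMap`, `globOp_kV`, `globOp_hypV`, `globOp_one`, `globOp_kV_mul`, `globOp_mul_kV`, `globOp_mem_unitary`,
  `continuous_globOp_apply`.

## Mathlib ∕ tree search
Tree: ★ `kakMap_surjective`, `isQuotientMap_kakMap`, `kV_weylKV_mul_hypV_mul_inv`, `kakMap_apply` (`RealUnitaryRankOneKAK`); ★ `kakMap_fibre`,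
`eq_of_kakMap_eq_of_nonneg`, `kakMap_zero_eq` (`RealUnitaryRankOneKAKFibers`); ★ `upqMaximalCompactEquiv` (`UpqMaximalCompactBlocks`).  Mathlib:
`Function.surjInv`, `Topology.IsQuotientMap.continuous_iff`, `unitary`, `ContRepresentation`.  Dedup: `rg "kakDescend|globOp" Literature/` — no hits.

## References
* [Knapp2002] A. W. Knapp, *Lie Groups Beyond an Introduction*, 2nd ed. (2002), VII §3, Thm. 7.39 (`G = K A⁺ K` and its fibres).
* [HarishChandra1953] Harish-Chandra, *Representations of a semisimple Lie group on a Banach space. I*, Trans. AMS 75 (1953), §9.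
-/

set_option autoImplicit false

noncomputable section

open Matrix Complex Topology Filter
open scoped ComplexConjugate MatrixGroups

namespace Literature.RepresentationTheory.KonnoKonno2007

namespace RealDualPair

open Literature.NumberTheory.Automorphic Literature.RepresentationTheory.BorelWallach2000
open Literature.RepresentationTheory.KonnoKonno2007.RealDualPair.UForm

variable {α β : Type*} [Fintype α] [DecidableEq α] [Fintype β] [DecidableEq β] (p₀ : α) (q₀ : β)

/-! ## §1 Descent of fibre-constant maps along the surjection `kakMap` -/

section Descend

variable [Subsingleton β] {Y : Type*}

/-- **Descent along `kakMap`**: evaluate `F : K × ℝ × K → Y` on a chosen `kakMap`-preimage (★ `kakMap_surjective`).  Meaningful for `F` constant on the fibres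
of `kakMap` (`kakDescend_kakMap`). [cite: Knapp2002, Thm. 7.39] -/
def kakDescend (F : KV α β × ℝ × KV α β → Y) : UForm α β → Y :=
  fun g => F (Function.surjInv (kakMap_surjective p₀ q₀) g)

/-- A fibre-constant `F` is recovered from its descent: `kakDescend F (k₁ a_t k₂) = F (k₁, t, k₂)`. [cite: Knapp2002, Thm. 7.39] -/
theorem kakDescend_kakMap {F : KV α β × ℝ × KV α β → Y} (hF : ∀ x y, kakMap p₀ q₀ x = kakMap p₀ q₀ y → F x = F y)
    (x : KV α β × ℝ × KV α β) : kakDescend p₀ q₀ F (kakMap p₀ q₀ x) = F x :=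
  hF _ _ (Function.surjInv_eq (kakMap_surjective p₀ q₀) (kakMap p₀ q₀ x))

/-- `kakDescend F ∘ kakMap = F` for fibre-constant `F`. [cite: Knapp2002, Thm. 7.39] -/
theorem kakDescend_comp_kakMap {F : KV α β × ℝ × KV α β → Y} (hF : ∀ x y, kakMap p₀ q₀ x = kakMap p₀ q₀ y → F x = F y) :
    kakDescend p₀ q₀ F ∘ kakMap p₀ q₀ = F :=
  funext fun x => kakDescend_kakMap p₀ q₀ hF x

/-- **Continuity descends** (★ `isQuotientMap_kakMap`): the descent of a continuous fibre-constant map is continuous on `U(α,β)`. [cite: Knapp2002, Thm. 7.39] -/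
theorem continuous_kakDescend [TopologicalSpace Y] {F : KV α β × ℝ × KV α β → Y}
    (hF : ∀ x y, kakMap p₀ q₀ x = kakMap p₀ q₀ y → F x = F y) (hFc : Continuous F) : Continuous (kakDescend p₀ q₀ F) := by
  rw [(isQuotientMap_kakMap p₀ q₀).continuous_iff, kakDescend_comp_kakMap p₀ q₀ hF]
  exact hFc

end Descend

/-! ## §2 The fibre-constancy criterion -/

section Criterion

variable [Subsingleton β] {Y : Type*}

omit [Subsingleton β] in
/-- `kV` is injective (block comparison). [cite: KonnoKonno2007, §3.1] -/
theorem eq_of_kV_eq {k k' : KV α β} (h : kV α β k = kV α β k') : k = k' := by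
  have h1 := congrArg (fun g : UForm α β => (((g : UForm α β) : GL (α ⊕ β) ℂ) : Matrix (α ⊕ β) (α ⊕ β) ℂ)) h
  simp only [UForm.coe_kV] at h1
  obtain ⟨h11, -, -, h22⟩ := Matrix.fromBlocks_inj.1 h1
  exact Prod.ext (Subtype.ext h11) (Subtype.ext h22)

omit [Subsingleton β] in
/-- The Weyl move does not change the product: `(k₁ w) a_{−t} (w⁻¹ k₂) = k₁ a_t k₂`. [cite: Knapp2002, VII §3] -/
theorem kakMap_weyl (k₁ : KV α β) (t : ℝ) (k₂ : KV α β) :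
    kakMap p₀ q₀ (k₁ * weylKV p₀, -t, (weylKV p₀)⁻¹ * k₂) = kakMap p₀ q₀ (k₁, t, k₂) := by
  rw [kakMap_apply, kakMap_apply, map_mul, map_mul, map_inv]
  have hw := kV_weylKV_mul_hypV_mul_inv p₀ q₀ (α := α) (β := β) (-t)
  rw [neg_neg] at hw
  calc kV α β k₁ * kV α β (weylKV p₀) * hypV p₀ q₀ (-t) * ((kV α β (weylKV p₀))⁻¹ * kV α β k₂)
      = kV α β k₁ * (kV α β (weylKV p₀) * hypV p₀ q₀ (-t) * (kV α β (weylKV p₀))⁻¹) * kV α β k₂ := by group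
    _ = kV α β k₁ * hypV p₀ q₀ t * kV α β k₂ := by rw [hw]

/-- **Fibre-constancy criterion.**  A map `F : K × ℝ × K → Y` is constant on the fibres of `kakMap` as soon as (W) it is invariant under the Weyl move
`(k₁, t, k₂) ↦ (k₁ w, −t, w⁻¹ k₂)`, (0) on `t = 0` it depends only on `k₁ k₂`, and (M) for `t > 0` it is invariant under `(k₁, t, k₂) ↦ (k₁ m, t, m⁻¹ k₂)` for
every `m ∈ K` whose block matrix commutes with the boost generator `H₀` (★ fibre lemma `kakMap_fibre`). [cite: Knapp2002, Thm. 7.39] -/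
theorem kakMap_fibreConstant_of (F : KV α β × ℝ × KV α β → Y)
    (hW : ∀ k₁ t k₂, F (k₁ * weylKV p₀, -t, (weylKV p₀)⁻¹ * k₂) = F (k₁, t, k₂))
    (h0 : ∀ k₁ k₂ k₁' k₂' : KV α β, k₁ * k₂ = k₁' * k₂' → F (k₁, 0, k₂) = F (k₁', 0, k₂'))
    (hM : ∀ (k₁ : KV α β) (t : ℝ) (k₂ m : KV α β), 0 < t →
      (((kV α β m : UForm α β) : GL (α ⊕ β) ℂ) : Matrix (α ⊕ β) (α ⊕ β) ℂ) *
          ((upqUnit (p₀, q₀) (-I) : (uFormGroup α β).lie) : Matrix (α ⊕ β) (α ⊕ β) ℂ) =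
        ((upqUnit (p₀, q₀) (-I) : (uFormGroup α β).lie) : Matrix (α ⊕ β) (α ⊕ β) ℂ) *
          (((kV α β m : UForm α β) : GL (α ⊕ β) ℂ) : Matrix (α ⊕ β) (α ⊕ β) ℂ) →
      F (k₁ * m, t, m⁻¹ * k₂) = F (k₁, t, k₂)) :
    ∀ x y, kakMap p₀ q₀ x = kakMap p₀ q₀ y → F x = F y := by
  -- normalisation to `t ≥ 0` by the Weyl move
  let Nm : KV α β × ℝ × KV α β → KV α β × ℝ × KV α β := fun x =>
    if x.2.1 < 0 then (x.1 * weylKV p₀, -x.2.1, (weylKV p₀)⁻¹ * x.2.2) else x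
  have hNm_map : ∀ x, kakMap p₀ q₀ (Nm x) = kakMap p₀ q₀ x := by
    rintro ⟨k₁, t, k₂⟩
    by_cases ht : t < 0
    · simp only [Nm, ht, if_true]
      exact kakMap_weyl p₀ q₀ k₁ t k₂
    · simp only [Nm, ht, if_false]
  have hNm_F : ∀ x, F (Nm x) = F x := by
    rintro ⟨k₁, t, k₂⟩
    by_cases ht : t < 0
    · simp only [Nm, ht, if_true]
      exact hW k₁ t k₂
    · simp only [Nm, ht, if_false]
  have hNm_nonneg : ∀ x, 0 ≤ (Nm x).2.1 := by
    rintro ⟨k₁, t, k₂⟩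
    by_cases ht : t < 0
    · simp only [Nm, ht, if_true]; linarith
    · simp only [Nm, ht, if_false]; linarith
  -- the case `t, t' ≥ 0`
  have key : ∀ x y : KV α β × ℝ × KV α β, 0 ≤ x.2.1 → 0 ≤ y.2.1 → kakMap p₀ q₀ x = kakMap p₀ q₀ y → F x = F y := by
    rintro ⟨k₁, t, k₂⟩ ⟨k₁', t', k₂'⟩ ht ht' h
    dsimp only at ht ht'
    have htt : t = t' := eq_of_kakMap_eq_of_nonneg p₀ q₀ ht ht' h
    subst htt
    rcases ht.eq_or_lt with ht0 | htpos
    · -- `t = 0`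
      subst ht0
      rw [kakMap_zero_eq, kakMap_zero_eq] at h
      exact h0 k₁ k₂ k₁' k₂' (eq_of_kV_eq h)
    · -- `t > 0`: the triples differ by `m ∈ M`
      obtain ⟨hm, hcomm⟩ := kakMap_fibre p₀ q₀ htpos.ne' h
      have hk₁' : k₁' = k₁ * (k₁⁻¹ * k₁') := by group
      have hk₂' : k₂' = (k₁⁻¹ * k₁')⁻¹ * k₂ := by rw [hm]; group
      rw [hk₁', hk₂']
      exact (hM k₁ t k₂ (k₁⁻¹ * k₁') htpos hcomm).symm
  intro x y h
  rw [← hNm_F x, ← hNm_F y]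
  exact key (Nm x) (Nm y) (hNm_nonneg x) (hNm_nonneg y) (by rw [hNm_map, hNm_map, h])

end Criterion

/-! ## §3 The operator family `globOp ϖK U₀ : U(α,β) → (E →L[ℂ] E)` -/

section GlobOp

variable [Subsingleton β]
variable {E : Type*} [NormedAddCommGroup E] [InnerProductSpace ℂ E]

omit [Subsingleton β] in
/-- Joint continuity for a strongly continuous contraction-valued family: if each `t ↦ f t v` is continuous and `‖f t‖ ≤ 1`, then `t ↦ f t (g t)` is
continuous for every continuous `g`. [cite: HarishChandra1953, §9] -/
theorem continuous_apply_of_strongly_continuous {T : Type*} [TopologicalSpace T] (f : T → (E →L[ℂ] E))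
    (hfc : ∀ v, Continuous fun t => f t v) (hfb : ∀ t, ‖f t‖ ≤ 1) {g : T → E} (hg : Continuous g) :
    Continuous fun t => f t (g t) := by
  refine continuous_iff_continuousAt.2 fun t₀ => ?_
  rw [ContinuousAt, tendsto_iff_norm_sub_tendsto_zero]
  have h1 : Tendsto (fun t => ‖g t - g t₀‖ + ‖f t (g t₀) - f t₀ (g t₀)‖) (𝓝 t₀) (𝓝 0) := by
    have hg' : Tendsto (fun t => ‖g t - g t₀‖) (𝓝 t₀) (𝓝 0) := by
      rw [← tendsto_iff_norm_sub_tendsto_zero]; exact hg.continuousAt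
    have hf' : Tendsto (fun t => ‖f t (g t₀) - f t₀ (g t₀)‖) (𝓝 t₀) (𝓝 0) := by
      rw [← tendsto_iff_norm_sub_tendsto_zero]; exact (hfc (g t₀)).continuousAt
    simpa using hg'.add hf'
  refine squeeze_zero (fun t => norm_nonneg _) (fun t => ?_) h1
  calc ‖f t (g t) - f t₀ (g t₀)‖ = ‖f t (g t - g t₀) + (f t (g t₀) - f t₀ (g t₀))‖ := by rw [map_sub]; abel_nf
    _ ≤ ‖f t (g t - g t₀)‖ + ‖f t (g t₀) - f t₀ (g t₀)‖ := norm_add_le _ _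
    _ ≤ ‖g t - g t₀‖ + ‖f t (g t₀) - f t₀ (g t₀)‖ := by
        gcongr
        exact ((f t).le_of_opNorm_le (hfb t) _).trans_eq (one_mul _)

variable (ϖK : ContRepresentation ℂ (uFormGroup α β).maximalCompact E) (U₀ : ℝ → (E →L[ℂ] E))

/-- **The operator family `Φ` on `U(α,β)` obtained by descent through `KAK`**: `globOp ϖK U₀ (k₁ a_t k₂) = ϖK(k₁) ∘ U₀(t) ∘ ϖK(k₂)` (`K` read through
★ `upqMaximalCompactEquiv`); the unitary globalization of an admissible `(𝔤, K)`-module of `U(2,1)` is this family for `U₀ = exp(t ρ(H₀))` on the completion.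
[cite: Knapp2002, Thm. 7.39] [cite: HarishChandra1953, §9] -/
def globOp : UForm α β → (E →L[ℂ] E) :=
  kakDescend p₀ q₀ fun x => ϖK (upqMaximalCompactEquiv.symm x.1) ∘L U₀ x.2.1 ∘L ϖK (upqMaximalCompactEquiv.symm x.2.2)

variable {ϖK U₀}

/-- The hypotheses (0), (M), (W) make `(k₁, t, k₂) ↦ ϖK(k₁) ∘ U₀(t) ∘ ϖK(k₂)` fibre-constant. [cite: Knapp2002, Thm. 7.39] -/
theorem fibreConstant_op (hU0 : U₀ 0 = 1)
    (hM : ∀ (m : KV α β) (t : ℝ), 0 < t →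
      (((kV α β m : UForm α β) : GL (α ⊕ β) ℂ) : Matrix (α ⊕ β) (α ⊕ β) ℂ) *
          ((upqUnit (p₀, q₀) (-I) : (uFormGroup α β).lie) : Matrix (α ⊕ β) (α ⊕ β) ℂ) =
        ((upqUnit (p₀, q₀) (-I) : (uFormGroup α β).lie) : Matrix (α ⊕ β) (α ⊕ β) ℂ) *
          (((kV α β m : UForm α β) : GL (α ⊕ β) ℂ) : Matrix (α ⊕ β) (α ⊕ β) ℂ) →
      ϖK (upqMaximalCompactEquiv.symm m) ∘L U₀ t = U₀ t ∘L ϖK (upqMaximalCompactEquiv.symm m))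
    (hW : ∀ t : ℝ, ϖK (upqMaximalCompactEquiv.symm (weylKV p₀ : KV α β)) ∘L U₀ t =
      U₀ (-t) ∘L ϖK (upqMaximalCompactEquiv.symm (weylKV p₀ : KV α β))) :
    ∀ x y, kakMap p₀ q₀ x = kakMap p₀ q₀ y →
      (fun x : KV α β × ℝ × KV α β => ϖK (upqMaximalCompactEquiv.symm x.1) ∘L U₀ x.2.1 ∘L ϖK (upqMaximalCompactEquiv.symm x.2.2)) x =
      (fun x : KV α β × ℝ × KV α β => ϖK (upqMaximalCompactEquiv.symm x.1) ∘L U₀ x.2.1 ∘L ϖK (upqMaximalCompactEquiv.symm x.2.2)) y := by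
  set e := (upqMaximalCompactEquiv (α := α) (β := β)).symm with he
  -- `ϖK (e a) (ϖK (e a⁻¹) x) = x`
  have hinv : ∀ (a : KV α β) (x : E), ϖK (e a) (ϖK (e a⁻¹) x) = x := fun a x => by
    rw [← ContinuousLinearMap.comp_apply, ← ContinuousLinearMap.mul_def, ← map_mul, ← map_mul, mul_inv_cancel, map_one, map_one]
    rfl
  refine kakMap_fibreConstant_of p₀ q₀ _ (fun k₁ t k₂ => ?_) (fun k₁ k₂ k₁' k₂' h => ?_) (fun k₁ t k₂ m ht hcomm => ?_)
  · -- Weyl move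
    have hW' := hW (-t)
    rw [neg_neg] at hW'
    have hWv : ∀ x, ϖK (e (weylKV p₀)) (U₀ (-t) x) = U₀ t (ϖK (e (weylKV p₀)) x) := fun x => by
      simpa only [ContinuousLinearMap.comp_apply] using congrArg (fun T : E →L[ℂ] E => T x) hW'
    ext v
    simp only [map_mul, ContinuousLinearMap.mul_def, ContinuousLinearMap.comp_apply, hWv, hinv]
  · -- `t = 0`
    ext v
    simp only [hU0, ContinuousLinearMap.one_def, ContinuousLinearMap.comp_apply, ContinuousLinearMap.id_apply]
    rw [← ContinuousLinearMap.comp_apply, ← ContinuousLinearMap.mul_def, ← map_mul, ← map_mul, h, map_mul, map_mul,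
      ContinuousLinearMap.mul_def, ContinuousLinearMap.comp_apply]
  · -- `M`-move at `t > 0`
    have hm := hM m t ht hcomm
    have hmv : ∀ x, ϖK (e m) (U₀ t x) = U₀ t (ϖK (e m) x) := fun x => by
      simpa only [ContinuousLinearMap.comp_apply] using congrArg (fun T : E →L[ℂ] E => T x) hm
    ext v
    simp only [map_mul, ContinuousLinearMap.mul_def, ContinuousLinearMap.comp_apply, hmv, hinv]

/-- **`globOp` on a `KAK` product**: `globOp ϖK U₀ (k₁ a_t k₂) = ϖK(k₁) ∘ U₀(t) ∘ ϖK(k₂)` (all `t ∈ ℝ`). [cite: Knapp2002, Thm. 7.39] -/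
theorem globOp_kakMap (hU0 : U₀ 0 = 1)
    (hM : ∀ (m : KV α β) (t : ℝ), 0 < t →
      (((kV α β m : UForm α β) : GL (α ⊕ β) ℂ) : Matrix (α ⊕ β) (α ⊕ β) ℂ) *
          ((upqUnit (p₀, q₀) (-I) : (uFormGroup α β).lie) : Matrix (α ⊕ β) (α ⊕ β) ℂ) =
        ((upqUnit (p₀, q₀) (-I) : (uFormGroup α β).lie) : Matrix (α ⊕ β) (α ⊕ β) ℂ) *
          (((kV α β m : UForm α β) : GL (α ⊕ β) ℂ) : Matrix (α ⊕ β) (α ⊕ β) ℂ) →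
      ϖK (upqMaximalCompactEquiv.symm m) ∘L U₀ t = U₀ t ∘L ϖK (upqMaximalCompactEquiv.symm m))
    (hW : ∀ t : ℝ, ϖK (upqMaximalCompactEquiv.symm (weylKV p₀ : KV α β)) ∘L U₀ t =
      U₀ (-t) ∘L ϖK (upqMaximalCompactEquiv.symm (weylKV p₀ : KV α β)))
    (k₁ : KV α β) (t : ℝ) (k₂ : KV α β) :
    globOp p₀ q₀ ϖK U₀ (kakMap p₀ q₀ (k₁, t, k₂)) =
      ϖK (upqMaximalCompactEquiv.symm k₁) ∘L U₀ t ∘L ϖK (upqMaximalCompactEquiv.symm k₂) :=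
  kakDescend_kakMap p₀ q₀ (fibreConstant_op p₀ q₀ hU0 hM hW) (k₁, t, k₂)

/-- `globOp` on `K`: `globOp (kV k) = ϖK k`. [cite: Knapp2002, Thm. 7.39] -/
theorem globOp_kV (hU0 : U₀ 0 = 1)
    (hM : ∀ (m : KV α β) (t : ℝ), 0 < t →
      (((kV α β m : UForm α β) : GL (α ⊕ β) ℂ) : Matrix (α ⊕ β) (α ⊕ β) ℂ) *
          ((upqUnit (p₀, q₀) (-I) : (uFormGroup α β).lie) : Matrix (α ⊕ β) (α ⊕ β) ℂ) =
        ((upqUnit (p₀, q₀) (-I) : (uFormGroup α β).lie) : Matrix (α ⊕ β) (α ⊕ β) ℂ) *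
          (((kV α β m : UForm α β) : GL (α ⊕ β) ℂ) : Matrix (α ⊕ β) (α ⊕ β) ℂ) →
      ϖK (upqMaximalCompactEquiv.symm m) ∘L U₀ t = U₀ t ∘L ϖK (upqMaximalCompactEquiv.symm m))
    (hW : ∀ t : ℝ, ϖK (upqMaximalCompactEquiv.symm (weylKV p₀ : KV α β)) ∘L U₀ t =
      U₀ (-t) ∘L ϖK (upqMaximalCompactEquiv.symm (weylKV p₀ : KV α β)))
    (k : KV α β) : globOp p₀ q₀ ϖK U₀ (kV α β k) = ϖK (upqMaximalCompactEquiv.symm k) := by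
  have h := globOp_kakMap p₀ q₀ hU0 hM hW k 0 1
  rwa [kakMap_apply, hypV_zero, mul_one, map_one, mul_one, hU0, map_one, map_one, ContinuousLinearMap.one_def,
    ContinuousLinearMap.comp_id, ContinuousLinearMap.comp_id] at h

/-- `globOp 1 = 1`. [cite: Knapp2002, Thm. 7.39] -/
theorem globOp_one (hU0 : U₀ 0 = 1)
    (hM : ∀ (m : KV α β) (t : ℝ), 0 < t →
      (((kV α β m : UForm α β) : GL (α ⊕ β) ℂ) : Matrix (α ⊕ β) (α ⊕ β) ℂ) *
          ((upqUnit (p₀, q₀) (-I) : (uFormGroup α β).lie) : Matrix (α ⊕ β) (α ⊕ β) ℂ) =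
        ((upqUnit (p₀, q₀) (-I) : (uFormGroup α β).lie) : Matrix (α ⊕ β) (α ⊕ β) ℂ) *
          (((kV α β m : UForm α β) : GL (α ⊕ β) ℂ) : Matrix (α ⊕ β) (α ⊕ β) ℂ) →
      ϖK (upqMaximalCompactEquiv.symm m) ∘L U₀ t = U₀ t ∘L ϖK (upqMaximalCompactEquiv.symm m))
    (hW : ∀ t : ℝ, ϖK (upqMaximalCompactEquiv.symm (weylKV p₀ : KV α β)) ∘L U₀ t =
      U₀ (-t) ∘L ϖK (upqMaximalCompactEquiv.symm (weylKV p₀ : KV α β))) :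
    globOp p₀ q₀ ϖK U₀ 1 = 1 := by
  have h := globOp_kV p₀ q₀ hU0 hM hW 1
  rwa [map_one, map_one, map_one] at h

/-- `globOp` on `A`: `globOp (a_t) = U₀ t` (negative `t` through the Weyl element). [cite: Knapp2002, Thm. 7.39] -/
theorem globOp_hypV (hU0 : U₀ 0 = 1)
    (hM : ∀ (m : KV α β) (t : ℝ), 0 < t →
      (((kV α β m : UForm α β) : GL (α ⊕ β) ℂ) : Matrix (α ⊕ β) (α ⊕ β) ℂ) *
          ((upqUnit (p₀, q₀) (-I) : (uFormGroup α β).lie) : Matrix (α ⊕ β) (α ⊕ β) ℂ) =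
        ((upqUnit (p₀, q₀) (-I) : (uFormGroup α β).lie) : Matrix (α ⊕ β) (α ⊕ β) ℂ) *
          (((kV α β m : UForm α β) : GL (α ⊕ β) ℂ) : Matrix (α ⊕ β) (α ⊕ β) ℂ) →
      ϖK (upqMaximalCompactEquiv.symm m) ∘L U₀ t = U₀ t ∘L ϖK (upqMaximalCompactEquiv.symm m))
    (hW : ∀ t : ℝ, ϖK (upqMaximalCompactEquiv.symm (weylKV p₀ : KV α β)) ∘L U₀ t =
      U₀ (-t) ∘L ϖK (upqMaximalCompactEquiv.symm (weylKV p₀ : KV α β)))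
    (t : ℝ) : globOp p₀ q₀ ϖK U₀ (hypV p₀ q₀ t) = U₀ t := by
  have h := globOp_kakMap p₀ q₀ hU0 hM hW 1 t 1
  rwa [kakMap_apply, map_one, one_mul, mul_one, map_one, map_one, ContinuousLinearMap.one_def, ContinuousLinearMap.comp_id,
    ContinuousLinearMap.id_comp] at h

/-- **Left `K`-covariance**: `globOp (kV k · g) = ϖK k ∘ globOp g`. [cite: Knapp2002, Thm. 7.39] -/
theorem globOp_kV_mul (hU0 : U₀ 0 = 1)
    (hM : ∀ (m : KV α β) (t : ℝ), 0 < t →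
      (((kV α β m : UForm α β) : GL (α ⊕ β) ℂ) : Matrix (α ⊕ β) (α ⊕ β) ℂ) *
          ((upqUnit (p₀, q₀) (-I) : (uFormGroup α β).lie) : Matrix (α ⊕ β) (α ⊕ β) ℂ) =
        ((upqUnit (p₀, q₀) (-I) : (uFormGroup α β).lie) : Matrix (α ⊕ β) (α ⊕ β) ℂ) *
          (((kV α β m : UForm α β) : GL (α ⊕ β) ℂ) : Matrix (α ⊕ β) (α ⊕ β) ℂ) →
      ϖK (upqMaximalCompactEquiv.symm m) ∘L U₀ t = U₀ t ∘L ϖK (upqMaximalCompactEquiv.symm m))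
    (hW : ∀ t : ℝ, ϖK (upqMaximalCompactEquiv.symm (weylKV p₀ : KV α β)) ∘L U₀ t =
      U₀ (-t) ∘L ϖK (upqMaximalCompactEquiv.symm (weylKV p₀ : KV α β)))
    (k : KV α β) (g : UForm α β) :
    globOp p₀ q₀ ϖK U₀ (kV α β k * g) = ϖK (upqMaximalCompactEquiv.symm k) ∘L globOp p₀ q₀ ϖK U₀ g := by
  obtain ⟨⟨k₁, t, k₂⟩, rfl⟩ := kakMap_surjective p₀ q₀ g
  have hk : kV α β k * kakMap p₀ q₀ (k₁, t, k₂) = kakMap p₀ q₀ (k * k₁, t, k₂) := by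
    rw [kakMap_apply, kakMap_apply, map_mul]; group
  rw [hk, globOp_kakMap p₀ q₀ hU0 hM hW, globOp_kakMap p₀ q₀ hU0 hM hW]
  simp only [map_mul, ContinuousLinearMap.mul_def, ContinuousLinearMap.comp_assoc]

/-- **Right `K`-covariance**: `globOp (g · kV k) = globOp g ∘ ϖK k`. [cite: Knapp2002, Thm. 7.39] -/
theorem globOp_mul_kV (hU0 : U₀ 0 = 1)
    (hM : ∀ (m : KV α β) (t : ℝ), 0 < t →
      (((kV α β m : UForm α β) : GL (α ⊕ β) ℂ) : Matrix (α ⊕ β) (α ⊕ β) ℂ) *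
          ((upqUnit (p₀, q₀) (-I) : (uFormGroup α β).lie) : Matrix (α ⊕ β) (α ⊕ β) ℂ) =
        ((upqUnit (p₀, q₀) (-I) : (uFormGroup α β).lie) : Matrix (α ⊕ β) (α ⊕ β) ℂ) *
          (((kV α β m : UForm α β) : GL (α ⊕ β) ℂ) : Matrix (α ⊕ β) (α ⊕ β) ℂ) →
      ϖK (upqMaximalCompactEquiv.symm m) ∘L U₀ t = U₀ t ∘L ϖK (upqMaximalCompactEquiv.symm m))
    (hW : ∀ t : ℝ, ϖK (upqMaximalCompactEquiv.symm (weylKV p₀ : KV α β)) ∘L U₀ t =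
      U₀ (-t) ∘L ϖK (upqMaximalCompactEquiv.symm (weylKV p₀ : KV α β)))
    (g : UForm α β) (k : KV α β) :
    globOp p₀ q₀ ϖK U₀ (g * kV α β k) = globOp p₀ q₀ ϖK U₀ g ∘L ϖK (upqMaximalCompactEquiv.symm k) := by
  obtain ⟨⟨k₁, t, k₂⟩, rfl⟩ := kakMap_surjective p₀ q₀ g
  have hk : kakMap p₀ q₀ (k₁, t, k₂) * kV α β k = kakMap p₀ q₀ (k₁, t, k₂ * k) := by
    rw [kakMap_apply, kakMap_apply, map_mul]; group
  rw [hk, globOp_kakMap p₀ q₀ hU0 hM hW, globOp_kakMap p₀ q₀ hU0 hM hW]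
  simp only [map_mul, ContinuousLinearMap.mul_def, ContinuousLinearMap.comp_assoc]

variable [CompleteSpace E]

/-- **`globOp g` is unitary** when `ϖK` and `U₀` are. [cite: HarishChandra1953, §9] -/
theorem globOp_mem_unitary (hU0 : U₀ 0 = 1)
    (hM : ∀ (m : KV α β) (t : ℝ), 0 < t →
      (((kV α β m : UForm α β) : GL (α ⊕ β) ℂ) : Matrix (α ⊕ β) (α ⊕ β) ℂ) *
          ((upqUnit (p₀, q₀) (-I) : (uFormGroup α β).lie) : Matrix (α ⊕ β) (α ⊕ β) ℂ) =
        ((upqUnit (p₀, q₀) (-I) : (uFormGroup α β).lie) : Matrix (α ⊕ β) (α ⊕ β) ℂ) *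
          (((kV α β m : UForm α β) : GL (α ⊕ β) ℂ) : Matrix (α ⊕ β) (α ⊕ β) ℂ) →
      ϖK (upqMaximalCompactEquiv.symm m) ∘L U₀ t = U₀ t ∘L ϖK (upqMaximalCompactEquiv.symm m))
    (hW : ∀ t : ℝ, ϖK (upqMaximalCompactEquiv.symm (weylKV p₀ : KV α β)) ∘L U₀ t =
      U₀ (-t) ∘L ϖK (upqMaximalCompactEquiv.symm (weylKV p₀ : KV α β)))
    (hϖu : ∀ k, ϖK k ∈ unitary (E →L[ℂ] E)) (hUu : ∀ t, U₀ t ∈ unitary (E →L[ℂ] E)) (g : UForm α β) :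
    globOp p₀ q₀ ϖK U₀ g ∈ unitary (E →L[ℂ] E) := by
  obtain ⟨⟨k₁, t, k₂⟩, rfl⟩ := kakMap_surjective p₀ q₀ g
  rw [globOp_kakMap p₀ q₀ hU0 hM hW, ← ContinuousLinearMap.mul_def, ← ContinuousLinearMap.mul_def]
  exact Submonoid.mul_mem _ (hϖu _) (Submonoid.mul_mem _ (hUu t) (hϖu _))

/-- **Strong continuity**: `g ↦ globOp g v` is continuous for every `v`, when `ϖK` and `U₀` are strongly continuous and unitary (★ `continuous_kakDescend`).
[cite: HarishChandra1953, §9] -/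
theorem continuous_globOp_apply (hU0 : U₀ 0 = 1)
    (hM : ∀ (m : KV α β) (t : ℝ), 0 < t →
      (((kV α β m : UForm α β) : GL (α ⊕ β) ℂ) : Matrix (α ⊕ β) (α ⊕ β) ℂ) *
          ((upqUnit (p₀, q₀) (-I) : (uFormGroup α β).lie) : Matrix (α ⊕ β) (α ⊕ β) ℂ) =
        ((upqUnit (p₀, q₀) (-I) : (uFormGroup α β).lie) : Matrix (α ⊕ β) (α ⊕ β) ℂ) *
          (((kV α β m : UForm α β) : GL (α ⊕ β) ℂ) : Matrix (α ⊕ β) (α ⊕ β) ℂ) →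
      ϖK (upqMaximalCompactEquiv.symm m) ∘L U₀ t = U₀ t ∘L ϖK (upqMaximalCompactEquiv.symm m))
    (hW : ∀ t : ℝ, ϖK (upqMaximalCompactEquiv.symm (weylKV p₀ : KV α β)) ∘L U₀ t =
      U₀ (-t) ∘L ϖK (upqMaximalCompactEquiv.symm (weylKV p₀ : KV α β)))
    (hϖu : ∀ k, ϖK k ∈ unitary (E →L[ℂ] E)) (hUu : ∀ t, U₀ t ∈ unitary (E →L[ℂ] E))
    (hϖc : ∀ v, Continuous fun k => ϖK k v) (hUc : ∀ v, Continuous fun t => U₀ t v) (v : E) :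
    Continuous fun g => globOp p₀ q₀ ϖK U₀ g v := by
  -- pointwise, `globOp g v` is the descent of `x ↦ F x v`
  have hfib := fibreConstant_op p₀ q₀ (ϖK := ϖK) (U₀ := U₀) hU0 hM hW
  have heq : (fun g => globOp p₀ q₀ ϖK U₀ g v) = kakDescend p₀ q₀ (fun x : KV α β × ℝ × KV α β =>
      (ϖK (upqMaximalCompactEquiv.symm x.1) ∘L U₀ x.2.1 ∘L ϖK (upqMaximalCompactEquiv.symm x.2.2)) v) := by
    funext g; rfl
  rw [heq]
  refine continuous_kakDescend p₀ q₀ (fun x y h => by simp only [hfib x y h]) ?_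
  -- joint continuity of `(k₁, t, k₂) ↦ ϖK k₁ (U₀ t (ϖK k₂ v))`
  have hb1 : ∀ k, ‖ϖK k‖ ≤ 1 := fun k =>
    ContinuousLinearMap.opNorm_le_bound _ zero_le_one fun x => by
      rw [ContinuousLinearMap.norm_map_of_mem_unitary (hϖu k), one_mul]
  have hb2 : ∀ t, ‖U₀ t‖ ≤ 1 := fun t =>
    ContinuousLinearMap.opNorm_le_bound _ zero_le_one fun x => by
      rw [ContinuousLinearMap.norm_map_of_mem_unitary (hUu t), one_mul]
  have hϖc' : ∀ w, Continuous fun x : KV α β × ℝ × KV α β => ϖK (upqMaximalCompactEquiv.symm x.2.2) w := fun w =>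
    (hϖc w).comp (upqMaximalCompactEquiv.symm.continuous.comp (continuous_snd.comp continuous_snd))
  have h3 : Continuous fun x : KV α β × ℝ × KV α β => ϖK (upqMaximalCompactEquiv.symm x.2.2) v := hϖc' v
  have h2 : Continuous fun x : KV α β × ℝ × KV α β => U₀ x.2.1 (ϖK (upqMaximalCompactEquiv.symm x.2.2) v) :=
    continuous_apply_of_strongly_continuous (fun x : KV α β × ℝ × KV α β => U₀ x.2.1)
      (fun w => (hUc w).comp (continuous_fst.comp continuous_snd)) (fun x => hb2 _) h3
  have h1 : Continuous fun x : KV α β × ℝ × KV α β =>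
      ϖK (upqMaximalCompactEquiv.symm x.1) (U₀ x.2.1 (ϖK (upqMaximalCompactEquiv.symm x.2.2) v)) :=
    continuous_apply_of_strongly_continuous (fun x : KV α β × ℝ × KV α β => ϖK (upqMaximalCompactEquiv.symm x.1))
      (fun w => (hϖc w).comp (upqMaximalCompactEquiv.symm.continuous.comp continuous_fst)) (fun x => hb1 _) h2
  simpa [ContinuousLinearMap.comp_apply] using h1

end GlobOp

end RealDualPair

end Literature.RepresentationTheory.KonnoKonno2007

end
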